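import Summits.QuantumFields.BalabanUV.Beta.FP.CoarseJetOrderTwoGradedComb

/-!
# `BalabanUV.Beta.FP.CoarseJetOrderTwoGradedCombJunction` — road «FP» (binder row D1), ROUTE T, the (J-a) dictionary's `hId₂` at the chart-(III′) tables:
# **THE DOOR's ORDER-2 WORD IN KKT-INVERSE CURRENCY** — leaf-05's graded order-2 effective-form word (`CoarseJetOrderTwoGraded.orderTwo_word_toBlocks₁₁_graded`,
# `CoarseJetOrderTwoGradedComb.torus_hId₂_iff_graded_comb`) IS `−(2·W·Ẋ·W·Ẋ·W − W·Ẍ·W)₂₂` with `W = (kkt H₀ [Q₁₀; τ₁])⁻¹ = [[Γ, 𝓘],[𝓘ᴸ, −𝔊]]`,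
# `Ẋ = [[H₁, −Bᵀ],[B, 0]]` (graded first jet), `Ẍ = [[H₂, B₂ᵀ],[B₂, 0]]` — the shape of an2's PART THREE response words
# (`CombHId2TorusWords`: `Â·D̂_b·Â·D̂_{b′}·Â + Â·D̂_{b′}·Â·D̂_b·Â − Â·Ŵ_{bb′}·Â`), junction J1 of my W-1 (CLAIMS l.50006)

HONEST DEPENDENCY (page 1, mandatory): continuum YM on T⁴ ⇐ BetaPertH ∧ nine spine estimates (0/9 proved); BetaPertH ⇐ (D1) ∧ (D4) ∧ CAP+tail;
G-an2-4 gates asym, D1 and NE2/3/4.  HONEST FRAMING (cell contract, verbatim): «discharging `BetaPertH` makes Bałaban's UV stability UNCONDITIONAL —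
a real constructive-QFT result; it is NOT the continuum limit and NOT the Clay problem.»  ABSOLUTE RULE (cell charter, verbatim): «No internally-minted
statement may enter as a cited fact. Every hypothesis is either kernel-proved in this package or a verbatim quotation of a PUBLISHED theorem with page
reference. The manuscript(s) under audit are NOT citable for their own disputed steps — they are the thing under adjudication; programme-internal
(2001/route/tribunal) claims are never citable.»

WHAT ([folklore] noncommutative polynomial algebra and `fromBlocks` bookkeeping BY NAME; no `def`, no `def … : Prop`, nothing cited, 0 sorry).
* §1 GENERIC (any field `𝕜`, any finite index types `ν`, `ρ`): **`orderTwo_word_eq_neg_toBlocks₂₂`** — for ALL `Γ H₁ H₂ : ν×ν`, `I : ν×ρ`, `L : ρ×ν`, `S : ρ×ρ`,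
  `B B₂ : ρ×ν`: the door's order-2 word `(((−((L·H₁ − S·B)·Γ − L·Bᵀ·L)·H₁ + L·H₂ − (((L·H₁ − S·B)·I + L·Bᵀ·S)·B + S·B₂))·I + (L·H₁ − S·B)·(−((Γ·H₁ + I·B)·I + Γ·Bᵀ·S)))`
  `− ((−((L·H₁ − S·B)·Γ − L·Bᵀ·L)·(−Bᵀ) + L·B₂ᵀ)·S + L·(−Bᵀ)·((L·H₁ − S·B)·I + L·Bᵀ·S))`
  `= −(2 • (W·Ẋ·W·Ẋ·W) − W·Ẍ·W).toBlocks₂₂`, `W := fromBlocks Γ I L (−S)`, `Ẋ := fromBlocks H₁ (−Bᵀ) B 0`, `Ẍ := fromBlocks H₂ B₂ᵀ B₂ 0`.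
* §2 AT THE SLICED KKT SYSTEM: `orderTwo_word_eq_neg_kktInv_word` — with `Γ 𝓘 𝓘ᴸ 𝔊` the four blocks of `(kkt H₀ C)⁻¹` (an2's `CompositionSingular.kktInv_eq_fromBlocks`),
  `W = (kkt H₀ C)⁻¹` itself; and **`torus_hId₂_iff_kktInv_word_comb`** — `CoarseJetOrderTwoGradedComb.torus_hId₂_iff_graded_comb` re-read:
  `hId₂ ↔ (−((2 • (W·Ẋ·W·Ẋ·W) − W·Ẍ·W).toBlocks₂₂)).toBlocks₁₁ = c • H′₂` with `W = (kkt H₀ [Q₁₀; τ₁])⁻¹` at the chart-(III′) literal, `B = [Q₁₁; 0]`, `B₂ = [Q₁₂; 0]`.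
* §3 UNGRADED: `thetaWord_eq_toBlocks₂₂` ∕ `thetaWord_eq_iff` — the door's `Θ∕Θᴸ∕Ŝ∕Γ̂` polynomial (the right side of `torus_hId₂_iff_graded_comb`) `=`
  `(2·Â·X̂·Â·X̂·Â − Â·X̂₂·Â)₂₂` with `Â := fromBlocks Γ̂ Θ Θᴸ Ŝ`, `X̂ := fromBlocks H₁ Q₁₁ᵀ Q₁₁ 0` SYMMETRIC, `X̂₂ := fromBlocks H₂ (−Q₁₂ᵀ) Q₁₂ 0`.
* §4 GENERIC LIVE-SLOT SANDWICH (any commutative ring, any injective slot map `e`): `sum_eq_sum_comp_of_support`, `submatrix_mul_of_rowSupport ∕ _of_colSupport`,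
  `colSupport_mul`, `submatrix_sandwich₃ ∕ ₅`, **`submatrix_responseWord`** — if `Â`'s rows and columns vanish off `range e` then
  `(2 • (Â·X·Â·X·Â) − Â·Y·Â)∘(e,e) = 2 • (â·x̂·â·x̂·â) − â·ŷ·â` (hats `= ∘(e,e)`): an2's words over ALL torus slots `Idx M (Fib d)` restrict to the live
  (field ⊕ coarse-multiplier) slots, where §3 reads them.
NOT HERE (J2, after an2's letters 2b∕2c land): `W`'s live corner IS `Â = perF M (GcombSh Lc j)` ((T-INV), `RelInvPeriodisedChartMinOp.torus_inv_kkt_of_slots_*`) and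
`Ẋ ∕ Ẍ ↔ Σ_b h_b • D̂_b ∕ Σ_{b b′} h_b h_{b′} • Ŵ_{bb′}` (an2's SPEC N-an2-g44-1).  Discharges NO binder of row D1; NOT the dictionary's `hId₂`, NOT (J-a), NOT (T-ID),
NOT SDF, NOT D1, NEVER «G-an2-4 closed», NOT BetaPertH, NOT continuum, NOT Clay; 0 estimates.  «not in print; our bookkeeping».
Unit `b2b-balaban-beta-d1-formalise-leaf-05` (gen 35), 2026-08-23; no existing file touched.
-/

noncomputable section

open scoped BigOperators Matrix

namespace Summit.QuantumFields.BalabanUV.Beta.FP.CoarseJetOrderTwoGradedCombJunction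

open Matrix
open Literature.MathematicalPhysics.QuantumFieldTheory.Balaban1983to89
open Literature.MathematicalPhysics.QuantumFieldTheory.Balaban1983to89.Beta
open Literature.MathematicalPhysics.QuantumFieldTheory.Balaban1983to89.Beta.Composition (kkt)
open Literature.MathematicalPhysics.QuantumFieldTheory.Balaban1983to89.Beta.CompositionSingular (effForm flucCov minOp minOpL kktInv_eq_fromBlocks)

/-! ## §1 Generic: the door's order-2 word is `−(2·W·Ẋ·W·Ẋ·W − W·Ẍ·W)₂₂` -/

section Generic

variable {𝕜 : Type*} [Field 𝕜]
variable {ν ρ : Type*} [Fintype ν] [Fintype ρ]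

/-- [folklore] **THE DOOR's ORDER-2 WORD IN INVERSE-BLOCK CURRENCY**: for all blocks, leaf-05's graded order-2 effective-form word equals
`−(2 • (W·Ẋ·W·Ẋ·W) − W·Ẍ·W).toBlocks₂₂` with `W = fromBlocks Γ I L (−S)`, `Ẋ = fromBlocks H₁ (−Bᵀ) B 0`, `Ẍ = fromBlocks H₂ B₂ᵀ B₂ 0` — the second
`u`-derivative of an inverse `W(u) = X(u)⁻¹` being `2·W·Ẋ·W·Ẋ·W − W·Ẍ·W`. -/
theorem orderTwo_word_eq_neg_toBlocks₂₂ (Γ H₁ H₂ : Matrix ν ν 𝕜) (I : Matrix ν ρ 𝕜) (L : Matrix ρ ν 𝕜) (S : Matrix ρ ρ 𝕜) (B B₂ : Matrix ρ ν 𝕜) :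
    (((-((L * H₁ - S * B) * Γ - L * Bᵀ * L) * H₁ + L * H₂
          - (((L * H₁ - S * B) * I + L * Bᵀ * S) * B + S * B₂)) * I
        + (L * H₁ - S * B) * (-((Γ * H₁ + I * B) * I + Γ * Bᵀ * S)))
      - ((-((L * H₁ - S * B) * Γ - L * Bᵀ * L) * (-Bᵀ) + L * (B₂)ᵀ) * S
          + L * (-Bᵀ) * ((L * H₁ - S * B) * I + L * Bᵀ * S)))
      = -((2 : 𝕜) • (fromBlocks Γ I L (-S) * fromBlocks H₁ (-Bᵀ) B 0 * fromBlocks Γ I L (-S) * fromBlocks H₁ (-Bᵀ) B 0 * fromBlocks Γ I L (-S))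
          - fromBlocks Γ I L (-S) * fromBlocks H₂ B₂ᵀ B₂ 0 * fromBlocks Γ I L (-S)).toBlocks₂₂ := by
  rw [sub_eq_add_neg (2 • _), ← neg_one_smul 𝕜 (fromBlocks Γ I L (-S) * fromBlocks H₂ B₂ᵀ B₂ 0 * fromBlocks Γ I L (-S))]
  simp only [fromBlocks_multiply, fromBlocks_smul, fromBlocks_add, toBlocks_fromBlocks₂₂, Matrix.mul_zero, add_zero]
  simp only [Matrix.mul_add, Matrix.add_mul, Matrix.mul_sub, Matrix.sub_mul, Matrix.neg_mul, Matrix.mul_neg, Matrix.mul_assoc, smul_add,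
    smul_neg, neg_neg, neg_add, neg_sub, sub_neg_eq_add, two_smul, neg_one_smul]
  abel

end Generic

/-! ## §2 At the sliced KKT system and at the chart-(III′) torus literal -/

section KKT

variable {𝕜 : Type*} [Field 𝕜]
variable {ν ρ : Type*} [Fintype ν] [Fintype ρ] [DecidableEq ν] [DecidableEq ρ]

/-- [folklore] **… IN KKT-INVERSE CURRENCY**: with `Γ 𝓘 𝓘ᴸ 𝔊` the four named blocks of `W := (kkt H₀ C)⁻¹` (an2's `kktInv_eq_fromBlocks`:
`W = fromBlocks Γ 𝓘 𝓘ᴸ (−𝔊)`), the door's order-2 word is `−(2 • (W·Ẋ·W·Ẋ·W) − W·Ẍ·W).toBlocks₂₂`. -/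
theorem orderTwo_word_eq_neg_kktInv_word (H₀ H₁ H₂ : Matrix ν ν 𝕜) (C B B₂ : Matrix ρ ν 𝕜)
    {Γ : Matrix ν ν 𝕜} {I : Matrix ν ρ 𝕜} {L : Matrix ρ ν 𝕜} {S : Matrix ρ ρ 𝕜}
    (hΓ : flucCov H₀ C = Γ) (hI : minOp H₀ C = I) (hL : minOpL H₀ C = L) (hS : effForm H₀ C = S) :
    (((-((L * H₁ - S * B) * Γ - L * Bᵀ * L) * H₁ + L * H₂
          - (((L * H₁ - S * B) * I + L * Bᵀ * S) * B + S * B₂)) * I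
        + (L * H₁ - S * B) * (-((Γ * H₁ + I * B) * I + Γ * Bᵀ * S)))
      - ((-((L * H₁ - S * B) * Γ - L * Bᵀ * L) * (-Bᵀ) + L * (B₂)ᵀ) * S
          + L * (-Bᵀ) * ((L * H₁ - S * B) * I + L * Bᵀ * S)))
      = -((2 : 𝕜) • ((kkt H₀ C)⁻¹ * fromBlocks H₁ (-Bᵀ) B 0 * (kkt H₀ C)⁻¹ * fromBlocks H₁ (-Bᵀ) B 0 * (kkt H₀ C)⁻¹)
          - (kkt H₀ C)⁻¹ * fromBlocks H₂ B₂ᵀ B₂ 0 * (kkt H₀ C)⁻¹).toBlocks₂₂ := by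
  rw [kktInv_eq_fromBlocks, hΓ, hI, hL, hS]
  exact orderTwo_word_eq_neg_toBlocks₂₂ Γ H₁ H₂ I L S B B₂

end KKT

section Torus

open Literature.Probability.LatticeModels (Torus.proj)
open B6Lemma24Torus (pbox)
open AffineAveraging (Site box toSite)
open AveragingContoursRooted (ctr ctrOff)
open OneStepResolventKernel (Fib)
open Summit.QuantumFields.BalabanUV.Beta.AxialDressingRooted (axEc)
open Summit.QuantumFields.BalabanUV.Beta.SymShiftedSpread (bhKStepSh)
open Summit.QuantumFields.BalabanUV.Beta.CombChartStepJets (GcombSh)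
open Summit.QuantumFields.BalabanUV.Beta.DshAn1 (Dsh)
open Summit.QuantumFields.BalabanUV.Beta.FP.KernelPeriodisationFib (Idx perF)
open Summit.QuantumFields.BalabanUV.Beta.FP.TorusCombRows (Res combRowsT)
open Summit.QuantumFields.BalabanUV.Beta.FP.CoarseJetOrderTwoGradedComb (torus_hId₂_iff_graded_comb)

variable {d : ℕ} {Lc : ℕ} [NeZero Lc] (M : Fin (d + 1) → ℕ) [∀ μ, NeZero (M μ)]

set_option synthInstance.maxSize 1024 in
/-- **[folklore] THE DICTIONARY's `hId₂` AT THE CHART-(III′) TABLES IS ONE IDENTITY OF KKT-INVERSE WORDS** (`CoarseJetOrderTwoGradedComb.torus_hId₂_iff_graded_comb`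
re-read through §1): with `W := (kkt H₀ [Q₁₀; τ₁])⁻¹`, `Ẋ := [[H₁, −[Q₁₁;0]ᵀ],[[Q₁₁;0], 0]]`, `Ẍ := [[H₂, [Q₁₂;0]ᵀ],[[Q₁₂;0], 0]]`,
`(§2's Θ-polynomial) = c • H′₂ ↔ (−((2 • (W·Ẋ·W·Ẋ·W) − W·Ẍ·W).toBlocks₂₂)).toBlocks₁₁ = c • H′₂` — the currency of an2's PART THREE response words. -/
theorem torus_hId₂_iff_kktInv_word_comb (hM : ∀ i, Lc ∣ M i) (j : ℕ)
    {μ : Type*} [Fintype μ] [DecidableEq μ] (fμ : μ → Idx M (Fib d)) (hfμ : Function.Injective fμ)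
    (hμ : ∀ a : μ, ∃ m : Fin (d + 1), (fμ a).2 = Sum.inr m)
    (hcoarse : ∀ (s : ↥(pbox M)) (m : Fin (d + 1)), ((s, Sum.inr m) : Idx M (Fib d)) ∈ Set.range fμ ↔ Torus.proj Lc (s : Site (d + 1)) = 0)
    {H₀ : Matrix (↥(pbox M) × Fin (d + 1)) (↥(pbox M) × Fin (d + 1)) ℝ} {Q₁₀ : Matrix μ (↥(pbox M) × Fin (d + 1)) ℝ}
    {τ₁ : Matrix (Res (ctr (d + 1) Lc) Lc M) (↥(pbox M) × Fin (d + 1)) ℝ}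
    (hH₀ : H₀ = (perF M (bhKStepSh d Lc (Dsh Lc) j)).submatrix
        (fun b : ↥(pbox M) × Fin (d + 1) => ((b.1, Sum.inl b.2) : Idx M (Fib d))) (fun b : ↥(pbox M) × Fin (d + 1) => ((b.1, Sum.inl b.2) : Idx M (Fib d))))
    (hQ₁₀ : Q₁₀ = (perF M (bhKStepSh d Lc (Dsh Lc) j)).submatrix fμ (fun b : ↥(pbox M) × Fin (d + 1) => ((b.1, Sum.inl b.2) : Idx M (Fib d))))
    (hτ₁ : τ₁ = (combRowsT (ctr (d + 1) Lc) Lc M).submatrix id (fun b : ↥(pbox M) × Fin (d + 1) => ((b.1, Sum.inl b.2) : Idx M (Fib d))))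
        (H₁ H₂ : Matrix (↥(pbox M) × Fin (d + 1)) (↥(pbox M) × Fin (d + 1)) ℝ) (Q₁₁ Q₁₂ : Matrix μ (↥(pbox M) × Fin (d + 1)) ℝ)
    {Θ : Matrix (↥(pbox M) × Fin (d + 1)) μ ℝ} {ΘL : Matrix μ (↥(pbox M) × Fin (d + 1)) ℝ} {Ŝ : Matrix μ μ ℝ}
    {Γc : Matrix (↥(pbox M) × Fin (d + 1)) (↥(pbox M) × Fin (d + 1)) ℝ}
    (hΘ : Θ = Matrix.of fun (b : ↥(pbox M) × Fin (d + 1)) (a : μ) =>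
        axEc (ctr (d + 1) Lc) Lc (b.1 : Site (d + 1)) (b.1 : Site (d + 1)) (Sum.inl b.2) (Sum.inl b.2)
          * perF M (GcombSh (d := d) Lc j) (b.1, Sum.inl b.2) (fμ a))
    (hΘL : ΘL = Matrix.of fun (a : μ) (b : ↥(pbox M) × Fin (d + 1)) =>
        axEc (ctr (d + 1) Lc) Lc (b.1 : Site (d + 1)) (b.1 : Site (d + 1)) (Sum.inl b.2) (Sum.inl b.2)
          * perF M (GcombSh (d := d) Lc j) (fμ a) (b.1, Sum.inl b.2))
    (hŜ : Ŝ = (perF M (GcombSh (d := d) Lc j)).submatrix fμ fμ)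
    (hΓc : Γc = Matrix.of fun (b b' : ↥(pbox M) × Fin (d + 1)) =>
        axEc (ctr (d + 1) Lc) Lc (b.1 : Site (d + 1)) (b.1 : Site (d + 1)) (Sum.inl b.2) (Sum.inl b.2)
          * (axEc (ctr (d + 1) Lc) Lc (b'.1 : Site (d + 1)) (b'.1 : Site (d + 1)) (Sum.inl b'.2) (Sum.inl b'.2)
            * perF M (GcombSh (d := d) Lc j) (b.1, Sum.inl b.2) (b'.1, Sum.inl b'.2)))
    (c : ℝ) (H'₂ : Matrix μ μ ℝ) :
    (((-((-ΘL * H₁ - Ŝ * Q₁₁) * Γc - -ΘL * Q₁₁ᵀ * -ΘL) * H₁ + -ΘL * H₂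
          - (((-ΘL * H₁ - Ŝ * Q₁₁) * Θ + -ΘL * Q₁₁ᵀ * Ŝ) * Q₁₁ + Ŝ * Q₁₂)) * Θ
        + (-ΘL * H₁ - Ŝ * Q₁₁) * (-((Γc * H₁ + Θ * Q₁₁) * Θ + Γc * Q₁₁ᵀ * Ŝ)))
      - ((-((-ΘL * H₁ - Ŝ * Q₁₁) * Γc - -ΘL * Q₁₁ᵀ * -ΘL) * (-Q₁₁ᵀ) + -ΘL * Q₁₂ᵀ) * Ŝ
          + -ΘL * (-Q₁₁ᵀ) * ((-ΘL * H₁ - Ŝ * Q₁₁) * Θ + -ΘL * Q₁₁ᵀ * Ŝ))) = c • H'₂ ↔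
      (-(((2 : ℝ) • ((kkt H₀ (fromRows Q₁₀ τ₁))⁻¹
              * fromBlocks H₁ (-(fromRows Q₁₁ (0 : Matrix (Res (ctr (d + 1) Lc) Lc M) (↥(pbox M) × Fin (d + 1)) ℝ))ᵀ)
                  (fromRows Q₁₁ (0 : Matrix (Res (ctr (d + 1) Lc) Lc M) (↥(pbox M) × Fin (d + 1)) ℝ)) 0
              * (kkt H₀ (fromRows Q₁₀ τ₁))⁻¹
              * fromBlocks H₁ (-(fromRows Q₁₁ (0 : Matrix (Res (ctr (d + 1) Lc) Lc M) (↥(pbox M) × Fin (d + 1)) ℝ))ᵀ)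
                  (fromRows Q₁₁ (0 : Matrix (Res (ctr (d + 1) Lc) Lc M) (↥(pbox M) × Fin (d + 1)) ℝ)) 0
              * (kkt H₀ (fromRows Q₁₀ τ₁))⁻¹)
          - (kkt H₀ (fromRows Q₁₀ τ₁))⁻¹
              * fromBlocks H₂ (fromRows Q₁₂ (0 : Matrix (Res (ctr (d + 1) Lc) Lc M) (↥(pbox M) × Fin (d + 1)) ℝ))ᵀ
                  (fromRows Q₁₂ (0 : Matrix (Res (ctr (d + 1) Lc) Lc M) (↥(pbox M) × Fin (d + 1)) ℝ)) 0
              * (kkt H₀ (fromRows Q₁₀ τ₁))⁻¹).toBlocks₂₂)).toBlocks₁₁ = c • H'₂ := by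
  rw [← torus_hId₂_iff_graded_comb M hM j fμ hfμ hμ hcoarse hH₀ hQ₁₀ hτ₁ rfl rfl rfl rfl H₁ H₂ Q₁₁ Q₁₂ rfl hΘ hΘL hŜ hΓc c H'₂,
    orderTwo_word_eq_neg_kktInv_word H₀ H₁ H₂ (fromRows Q₁₀ τ₁) _ _ rfl rfl rfl rfl]

end Torus

/-! ## §3 The same word UNGRADED: in the natural blocks `Â = [[Γ̂, Θ],[Θᴸ, Ŝ]]` the first jet enters symmetrically, the second border jet with `−Q₁₂ᵀ` -/

section Hat

variable {𝕜 : Type*} [Field 𝕜]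
variable {ν μ : Type*} [Fintype ν] [Fintype μ]

/-- [folklore] **THE DOOR's `Θ∕Θᴸ∕Ŝ∕Γ̂` POLYNOMIAL IS `(2·Â·X̂·Â·X̂·Â − Â·X̂₂·Â)₂₂`** with `Â := fromBlocks Γ̂ Θ Θᴸ Ŝ` (no signs, no masks),
`X̂ := fromBlocks H₁ Q₁₁ᵀ Q₁₁ 0` (the SYMMETRIC first jet) and `X̂₂ := fromBlocks H₂ (−Q₁₂ᵀ) Q₁₂ 0` — for ALL blocks (one of the four sign placements that match,
found by exact rational search; the others are its `diag(1, −1)`-conjugates). -/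
theorem thetaWord_eq_toBlocks₂₂ (Γc H₁ H₂ : Matrix ν ν 𝕜) (Θ : Matrix ν μ 𝕜) (ΘL : Matrix μ ν 𝕜) (Ŝ : Matrix μ μ 𝕜) (Q₁₁ Q₁₂ : Matrix μ ν 𝕜) :
    ((-((-ΘL * H₁ - Ŝ * Q₁₁) * Γc - -ΘL * Q₁₁ᵀ * -ΘL) * H₁ + -ΘL * H₂
          - (((-ΘL * H₁ - Ŝ * Q₁₁) * Θ + -ΘL * Q₁₁ᵀ * Ŝ) * Q₁₁ + Ŝ * Q₁₂)) * Θ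
        + (-ΘL * H₁ - Ŝ * Q₁₁) * (-((Γc * H₁ + Θ * Q₁₁) * Θ + Γc * Q₁₁ᵀ * Ŝ)))
      - ((-((-ΘL * H₁ - Ŝ * Q₁₁) * Γc - -ΘL * Q₁₁ᵀ * -ΘL) * (-Q₁₁ᵀ) + -ΘL * Q₁₂ᵀ) * Ŝ
          + -ΘL * (-Q₁₁ᵀ) * ((-ΘL * H₁ - Ŝ * Q₁₁) * Θ + -ΘL * Q₁₁ᵀ * Ŝ))
      = ((2 : 𝕜) • (fromBlocks Γc Θ ΘL Ŝ * fromBlocks H₁ Q₁₁ᵀ Q₁₁ 0 * fromBlocks Γc Θ ΘL Ŝ * fromBlocks H₁ Q₁₁ᵀ Q₁₁ 0 * fromBlocks Γc Θ ΘL Ŝ)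
          - fromBlocks Γc Θ ΘL Ŝ * fromBlocks H₂ (-Q₁₂ᵀ) Q₁₂ 0 * fromBlocks Γc Θ ΘL Ŝ).toBlocks₂₂ := by
  rw [sub_eq_add_neg (2 • _), ← neg_one_smul 𝕜 (fromBlocks Γc Θ ΘL Ŝ * fromBlocks H₂ (-Q₁₂ᵀ) Q₁₂ 0 * fromBlocks Γc Θ ΘL Ŝ)]
  simp only [fromBlocks_multiply, fromBlocks_smul, fromBlocks_add, toBlocks_fromBlocks₂₂, Matrix.mul_zero, add_zero]
  simp only [Matrix.mul_add, Matrix.add_mul, Matrix.mul_sub, Matrix.sub_mul, Matrix.neg_mul, Matrix.mul_neg, Matrix.mul_assoc, smul_add,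
    smul_neg, neg_neg, neg_add, neg_sub, sub_neg_eq_add, two_smul, neg_one_smul]
  abel

/-- [folklore] hence the door's `hId₂` (`CoarseJetOrderTwoGradedComb.torus_hId₂_iff_graded_comb`'s right side, whose blocks ARE `Â = perF M (GcombSh Lc j)`'s
masked blocks) reads `(2·Â·X̂·Â·X̂·Â − Â·X̂₂·Â)₂₂ = c • H′₂` — an2's PART THREE response word `2·Â·D̂_h·Â·D̂_h·Â − Â·Ŵ_{hh}·Â` on the coarse slots, with
`D̂_h ↔ X̂` symmetric and `Ŵ_{hh} ↔ X̂₂ = [[H₂, −Q₁₂ᵀ],[Q₁₂, 0]]`. -/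
theorem thetaWord_eq_iff (Γc H₁ H₂ : Matrix ν ν 𝕜) (Θ : Matrix ν μ 𝕜) (ΘL : Matrix μ ν 𝕜) (Ŝ : Matrix μ μ 𝕜) (Q₁₁ Q₁₂ : Matrix μ ν 𝕜)
    (c : 𝕜) (H'₂ : Matrix μ μ 𝕜) :
    ((-((-ΘL * H₁ - Ŝ * Q₁₁) * Γc - -ΘL * Q₁₁ᵀ * -ΘL) * H₁ + -ΘL * H₂
          - (((-ΘL * H₁ - Ŝ * Q₁₁) * Θ + -ΘL * Q₁₁ᵀ * Ŝ) * Q₁₁ + Ŝ * Q₁₂)) * Θ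
        + (-ΘL * H₁ - Ŝ * Q₁₁) * (-((Γc * H₁ + Θ * Q₁₁) * Θ + Γc * Q₁₁ᵀ * Ŝ)))
      - ((-((-ΘL * H₁ - Ŝ * Q₁₁) * Γc - -ΘL * Q₁₁ᵀ * -ΘL) * (-Q₁₁ᵀ) + -ΘL * Q₁₂ᵀ) * Ŝ
          + -ΘL * (-Q₁₁ᵀ) * ((-ΘL * H₁ - Ŝ * Q₁₁) * Θ + -ΘL * Q₁₁ᵀ * Ŝ)) = c • H'₂
      ↔ ((2 : 𝕜) • (fromBlocks Γc Θ ΘL Ŝ * fromBlocks H₁ Q₁₁ᵀ Q₁₁ 0 * fromBlocks Γc Θ ΘL Ŝ * fromBlocks H₁ Q₁₁ᵀ Q₁₁ 0 * fromBlocks Γc Θ ΘL Ŝ)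
          - fromBlocks Γc Θ ΘL Ŝ * fromBlocks H₂ (-Q₁₂ᵀ) Q₁₂ 0 * fromBlocks Γc Θ ΘL Ŝ).toBlocks₂₂ = c • H'₂ := by
  rw [thetaWord_eq_toBlocks₂₂]

end Hat

/-! ## §4 Generic: sandwiches by a live-supported matrix restrict to the live slots (an2's words over ALL torus slots ↦ §3's block words) -/

section Live

variable {R : Type*} [CommRing R] {ι α β : Type*} [Fintype ι] [Fintype α] [DecidableEq ι]

/-- [folklore] a sum over all slots of a function vanishing off the range of an injective slot map is the sum over the slots. -/
theorem sum_eq_sum_comp_of_support {e : α → ι} (he : Function.Injective e) (f : ι → R) (hf : ∀ P, P ∉ Set.range e → f P = 0) :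
    ∑ P, f P = ∑ a, f (e a) := by
  classical
  rw [← Finset.sum_image (f := f) (fun a _ b _ h => he h)]
  refine (Finset.sum_subset (Finset.subset_univ _) fun P _ hP => hf P fun ⟨a, ha⟩ => hP ?_).symm
  exact Finset.mem_image.2 ⟨a, Finset.mem_univ a, ha⟩

/-- [folklore] **right factor live-ROW-supported**: `(Y·Â)∘(r,e) = Y∘(r,e)·Â∘(e,e)` for any row selection `r`. -/
theorem submatrix_mul_of_rowSupport {e : α → ι} (he : Function.Injective e) (Y A : Matrix ι ι R)
    (hA : ∀ P Q, P ∉ Set.range e → A P Q = 0) (r : β → ι) :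
    (Y * A).submatrix r e = Y.submatrix r e * A.submatrix e e := by
  ext b a
  simp only [submatrix_apply, Matrix.mul_apply]
  exact sum_eq_sum_comp_of_support he _ fun P hP => by rw [hA P _ hP, mul_zero]

/-- [folklore] **left factor live-COLUMN-supported**: `(Â·Y)∘(e,c) = Â∘(e,e)·Y∘(e,c)` for any column selection `c`. -/
theorem submatrix_mul_of_colSupport {e : α → ι} (he : Function.Injective e) (A Y : Matrix ι ι R)
    (hA : ∀ P Q, Q ∉ Set.range e → A P Q = 0) (c : β → ι) :
    (A * Y).submatrix e c = A.submatrix e e * Y.submatrix e c := by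
  ext a b
  simp only [submatrix_apply, Matrix.mul_apply]
  exact sum_eq_sum_comp_of_support he _ fun P hP => by rw [hA _ P hP, zero_mul]

omit [Fintype α] [DecidableEq ι] in
/-- [folklore] a product ENDING in a live-column-supported factor is live-column-supported. -/
theorem colSupport_mul {e : α → ι} (Y A : Matrix ι ι R) (hA : ∀ P Q, Q ∉ Set.range e → A P Q = 0) :
    ∀ P Q, Q ∉ Set.range e → (Y * A) P Q = 0 := fun P Q hQ => by
  rw [Matrix.mul_apply]
  exact Finset.sum_eq_zero fun R _ => by rw [hA R Q hQ, mul_zero]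

/-- **[folklore] THE THREE-FACTOR SANDWICH ON THE LIVE SLOTS**: rows and columns of `Â` vanishing off `range e` give
`(Â·X·Â)∘(e,e) = Â∘(e,e)·X∘(e,e)·Â∘(e,e)` for every `X`. -/
theorem submatrix_sandwich₃ {e : α → ι} (he : Function.Injective e) (A X : Matrix ι ι R)
    (hr : ∀ P Q, P ∉ Set.range e → A P Q = 0) (hc : ∀ P Q, Q ∉ Set.range e → A P Q = 0) :
    (A * X * A).submatrix e e = A.submatrix e e * X.submatrix e e * A.submatrix e e := by
  rw [submatrix_mul_of_rowSupport he (A * X) A hr e, submatrix_mul_of_colSupport he A X hc e]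

/-- **[folklore] THE FIVE-FACTOR SANDWICH ON THE LIVE SLOTS**: `(Â·X·Â·Y·Â)∘(e,e) = Â∘(e,e)·X∘(e,e)·Â∘(e,e)·Y∘(e,e)·Â∘(e,e)` for all `X Y`. -/
theorem submatrix_sandwich₅ {e : α → ι} (he : Function.Injective e) (A X Y : Matrix ι ι R)
    (hr : ∀ P Q, P ∉ Set.range e → A P Q = 0) (hc : ∀ P Q, Q ∉ Set.range e → A P Q = 0) :
    (A * X * A * Y * A).submatrix e e = A.submatrix e e * X.submatrix e e * A.submatrix e e * Y.submatrix e e * A.submatrix e e := by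
  rw [submatrix_mul_of_rowSupport he (A * X * A * Y) A hr e, submatrix_mul_of_colSupport he (A * X * A) Y (colSupport_mul (A * X) A hc) e,
    submatrix_sandwich₃ he A X hr hc]

/-- **[folklore] an2's RESPONSE WORD ON THE LIVE SLOTS**: `(2 • (Â·X·Â·X·Â) − Â·Y·Â)∘(e,e) = 2 • (â·x̂·â·x̂·â) − â·ŷ·â` with hats = `∘(e,e)`. -/
theorem submatrix_responseWord {e : α → ι} (he : Function.Injective e) (A X Y : Matrix ι ι R)
    (hr : ∀ P Q, P ∉ Set.range e → A P Q = 0) (hc : ∀ P Q, Q ∉ Set.range e → A P Q = 0) :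
    ((2 : R) • (A * X * A * X * A) - A * Y * A).submatrix e e
      = (2 : R) • (A.submatrix e e * X.submatrix e e * A.submatrix e e * X.submatrix e e * A.submatrix e e)
          - A.submatrix e e * Y.submatrix e e * A.submatrix e e := by
  rw [← submatrix_sandwich₅ he A X X hr hc, ← submatrix_sandwich₃ he A Y hr hc]
  rfl

end Live

end Summit.QuantumFields.BalabanUV.Beta.FP.CoarseJetOrderTwoGradedCombJunction

end
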